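import Summits.NavierStokesRegularity.NavierStokesRegularity.Theses.PalasekTowerBreakdown
import Summits.NavierStokesRegularity.FluidComputer.PalasekTowerStrainDoorAtHybrid

/-!
# `EpisodeBaseT` (crux stmt-NavierStokesRegularity-20303, K1 at `TowerRates.tuned`) from ONE HYBRID-CURRENCY STRAIN
# CERTIFICATE — BY NAME (route (A′): `H¹` letter on the window, `H²` by smoothing on sliding windows)

Cell `ns-blowup`, seat `ns-blowup-fc-prover-2` (g10; D-0074 GROUP C «BRIDGE SUPPORT»). Route `PalasekTowerBreakdown` after
the RE-BASE (rev 19): `EpisodeBaseT := EpisodeBaseGAt TowerRates.tuned`. Composition of the HYBRID-currency certificate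
letter `StrainDoor.CertificateDataHybrid` (`PalasekTowerStrainDoorAtHybrid.lean`, this seat: the hybrid existence door
`StrainShadowHybrid.exists_freeRun_near_of_strainHybrid` + the currency-free core
`StrainDoor.episodeBaseGAt_of_mechanismDoorAt_of_nearFreeRun`, LEAD p530553) with the PAID mechanism door at `tuned`
(`Germ.mechanismDoorAt_of_boxNumerics TowerRates.tuned_boxNumerics`, ecbridge-3 p537983). LABEL: E–C typing (KERNEL:
theorem only; `--supports` stmt-NavierStokesRegularity-20303). WHAT THIS IS NOT: not Navier–Stokes evidence — no hybrid
certificate is exhibited (its `agmonConst` fields are not even numeric before the `AgmonBoundR3` re-thread);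
`EpisodeBaseT` appears only as the conclusion of a conditional; nothing about `RungG 1` or blow-up is asserted.

* `palasekTowerBreakdown_episodeBaseT_of_certificateDataHybrid` — ONE `StrainDoor.CertificateDataHybrid TowerRates.tuned …`
  ⟹ `EpisodeBaseT`.

References: S. Palasek, arXiv:2605.13827 §4 [cite: Palasek2026ElementaryModel, §4]; T. Tao, Anal. PDE 6 (2013) Thm. 5.4
[cite: Tao2011, Thm. 5.4 (ii)+(iv)]; Dashti–Robinson 2008 [cite: DashtiRobinson2008, Thm 1, Thm 2].
-/

noncomputable section

-- `Summit.<Summit>.<Problem>` is the tree's mandated summit-side namespace (CONVENTIONS §2); for this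
-- single-conjunct summit the two coincide, so the duplicate is deliberate.
set_option linter.dupNamespace false

namespace Summit.NavierStokesRegularity.NavierStokesRegularity.Theorems

open Summit.NavierStokesRegularity.NavierStokesRegularity.Theses
open Summit.NavierStokesRegularity.FluidComputer.PalasekTowerClayBridge

/-- **`EpisodeBaseT` FROM ONE HYBRID-CURRENCY STRAIN CERTIFICATE AT `tuned`** (the mechanism door is paid by
`Germ.mechanismDoorAt_of_boxNumerics TowerRates.tuned_boxNumerics`; the certificate letter is
`StrainDoor.CertificateDataHybrid TowerRates.tuned …`). [cite: Palasek2026ElementaryModel, §4] [cite: Tao2011, Thm. 5.4 (ii)+(iv)] -/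
theorem palasekTowerBreakdown_episodeBaseT_of_certificateDataHybrid
    {U : EuclideanSpace ℝ (Fin 3) → EuclideanSpace ℝ (Fin 3)} {ρ : ℝ}
    {w r : ℝ → EuclideanSpace ℝ (Fin 3) → EuclideanSpace ℝ (Fin 3)} {ϖ : ℝ → EuclideanSpace ℝ (Fin 3) → ℝ}
    {G σ₂ σ₃ Rr L H₁ ψ₁ ψ₂ X₁ Dτ Ψτ : ℝ → ℝ} {Bw E₀ κ μ D₁ Ψ₁ D₂ Ψ₂ δ η τw : ℝ}
    (c : StrainDoor.CertificateDataHybrid TowerRates.tuned U ρ w r ϖ G σ₂ σ₃ Rr L H₁ ψ₁ ψ₂ X₁ Dτ Ψτ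
      Bw E₀ κ μ D₁ Ψ₁ D₂ Ψ₂ δ η τw) :
    PalasekTowerBreakdown.EpisodeBaseT := by
  unfold PalasekTowerBreakdown.EpisodeBaseT
  exact StrainDoor.episodeBaseGAt_tuned_of_certificateDataHybrid c

end Summit.NavierStokesRegularity.NavierStokesRegularity.Theorems

end
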